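/-
Copyright (c) 2026 the pub-hodgecm-mathlib formalisation cell (harness21).  Prover seat hodgecm-mathlib-A-p19 (g29): road «S3-ram» (LEAD F0P3a-plan (g13); owner ∕ (α) keeper
F0P3a-p06 (g16); (Cnt2′) chair F0P3a-p07 (g15)), organ «J2-FRAME-hyp» FILE 4: the W-SIDE ROOT-REGION TRANSPORT along the frame `(k, s)`; 2026-09-02.
-/
import Literature.NumberTheory.Rogawski1990.TypeTwoRamifiedFrameLiteralDepth                   -- ★ p849294 (this seat): FILES 1–3 (frame, CM dress, root depth)
import Literature.NumberTheory.Automorphic.UnitaryLatticeTreeBlockRootRegionAxis                 -- ★ p849125 (F0P3a-p01 (g18)): THM 5 `ncard_rootRegion_eq_ncard_two_of_coe_eq_endoGL`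
import Literature.NumberTheory.Rogawski1990.DepthZeroKappaTransferTypeTwoRamifiedWSideBalls       -- ★ p848780 (A-p12): `selfDual_fixed_lev_eq_ball_of_le` (LEV ↔ centred ball), the ball counts
import Literature.NumberTheory.Automorphic.UnitaryLatticeTreeBlockTubeBoundFixedFinite           -- ★ (A-p19 (g28)): `eval_charpoly_fin_two_eq_det_sub_smul_one`
import Literature.NumberTheory.Rogawski1990.UnitaryVertexStabilizerCoverCM                         -- ★ `isPrincipalIdealRing_integer_adicCompletion`
import HarnessLib

/-!
# THE W-SIDE ROOT REGION OF THE RE-ROOTED CENTRED HYPERBOLIC LITERAL, TRANSPORTED ALONG THE FRAME `(k, s)` TO A-p12's CENTRED BALLS OF `ĝ_w`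
# (Kottwitz 1986 §3; Rogawski 1990 §4.9; Labesse–Langlands 1979 §2; Bruhat–Tits 1972 §10)

Topic `NumberTheory/Rogawski1990`; namespaces `Literature.NumberTheory.Automorphic.UnitaryLatticeTree` (§1–§2, generic `K`) and `Literature.NumberTheory.Rogawski1990` (§3, CM
dress).  THEOREMS ONLY (no definition, no instance, no notation, no named fact, no `sorry`); kernel lane `--supports stmt-HodgeConjecture-24833`.  Cell `pub/hodgecm-mathlib`
(D-0151), crux H413; road «S3-ram» (count-neutral): the (α) BLOCK-LAW skeleton, hyperbolic cells `stub_Zhyp_*` (pen F0P3a-p08 (g20), ★ p849287: «`R := sR.card` = ★ THM 5 ∘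
A-p12 W-ball count») and F0P3a-p01 (g18)'s regime-A root census (`hWtop`).  THE GAP CLOSED HERE: THM 5 (★ p849125) reads the root region of `Γ = ι(B₀, 1)` as the W-side set
`{B ∣ SD_{Φ₂} B ∧ B₀·B = B ∧ (B₀ − 1)B ⊆ ϖ^{d}B}` of the RE-ROOTED CENTRED block `B₀ = k⁻¹(s·ĝ_w)k`, while A-p12 (g25)'s ★ W-side pack counts the CENTRED BALLS
`{B ∣ SD B ∧ ĝ_w·B = B ∧ (ĝ_w − ½tr ĝ_w·1)B ⊆ ϖ^{d}B}` of the UNCENTRED one-place image `ĝ_w`.  The bridge: (i) for `|2û₀₀ − tr ĝ_w| ≤ |ϖ^d|` the level token of `B₀` IS its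
centred-ball token (★ A-p12 `selfDual_fixed_lev_eq_ball_of_le`, `½tr B₀ − 1 = s·½tr ĝ_w − 1` has valuation `|2û₀₀ − tr ĝ_w|`, ★ FILE 2 ED. 2); (ii) `B₀ − ½tr B₀·1 =
k⁻¹·(s·(ĝ_w − ½tr ĝ_w·1))·k`, so `B ↦ k·B` carries the centred ball of `B₀` onto that of `ĝ_w` (`k` unitary, `|s| = 1`).  §3 also discharges THM 5's value-gap `hdet` from the
J0diff's `hm`: `det(B₀ − 1) = s²·χ_{ĝ_w}(û₀₀)` and `|χ_{ĝ_w}(û₀₀)|_w = |ι_w ϖ_v^m| = |ϖ|^{2m}`, so `|ϖ|^{2d+1} < |det(B₀ − 1)|` iff `m ≤ d`.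

* §1 `trace_coe_conj_scalar_mul`, **`coe_conj_scalar_mul_sub_half_trace_eq`**, **`det_coe_conj_scalar_mul_sub_one`**; §2 `map_toLin'_smul_le_scaleLattice_iff`,
  **`ncard_selfDual_fixed_centredBall_conj_scalar_mul_eq`** (+ the `k⁻¹ _ k` spelling `…_inv_conj_…`).
* §3 (CM) **`ncard_selfDual_fixed_lev_rerootedCentred_eq_ncard_ball_ram`** (THM 5's W-side set of `B₀` at scale `d` = A-p12's centred ball of `ĝ_w` at scale `d`, under
  `|2û₀₀ − tr ĝ_w| ≤ |ϖ^d|`), `v_det_rerootedCentred_sub_one_eq_ram` (`|det(↑B₀ − 1)| = |ϖ|^(2m)` from `hm`), **`ncard_rootRegion_rerootedCentred_eq_ncard_ball_ram`**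
  (the root region of `Γ` at level `d`, `m ≤ d`, `|2û₀₀ − tr ĝ_w| ≤ |ϖ^d|`, counted by A-p12's centred ball — the pen's `sR.card`; regime B: `d = m`).
HONEST LABEL: HC_CM is proved only modulo the 2 remaining named inputs (hLiu418 24832, h413 24833) until rung 0 closes; unconditional local algebra, count-neutral.

## References
* [Kottwitz1986] R. E. Kottwitz, *Base change for unit elements of Hecke algebras*, Compositio Math. 60 (1986), §3.
* [Rogawski1990] J. D. Rogawski, *Automorphic Representations of Unitary Groups in Three Variables*, Ann. of Math. Stud. 123 (1990), §4.9 pp. 54–56, Lemma 4.9.3.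
* [LabesseLanglands1979] J.-P. Labesse, R. P. Langlands, *L-indistinguishability for SL(2)*, Canad. J. Math. 31 (1979), §2 Lemma 2.1 p. 8.
* [BruhatTits1972] F. Bruhat, J. Tits, *Groupes réductifs sur un corps local I*, Publ. Math. IHÉS 41 (1972), §10.
-/

set_option autoImplicit false

noncomputable section

open scoped Valued WithZero Matrix MatrixGroups
open Polynomial NumberField IsDedekindDomain
open Literature.NumberTheory.Automorphic Literature.NumberTheory.Automorphic.HermitianLattice Literature.NumberTheory.Automorphic.UnitaryLatticeTree
open Literature.NumberTheory.Automorphic.UnitaryGroup Literature.NumberTheory.GaloisRepresentations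
open Literature.NumberTheory.Rogawski1990

namespace Literature.NumberTheory.Automorphic.UnitaryLatticeTree

section Generic

variable {K : Type*} [Field K]

/-- `tr(P·(s·g)·P⁻¹) = s·tr g`. [cite: Kottwitz1986, §3] -/
theorem trace_coe_conj_scalar_mul (P g : GL (Fin 2) K) (s : Kˣ) :
    ((P * (Matrix.GeneralLinearGroup.scalar (Fin 2) s * g) * P⁻¹ : GL (Fin 2) K) : Matrix (Fin 2) (Fin 2) K).trace = (s : K) * (g : Matrix (Fin 2) (Fin 2) K).trace := by
  rw [Units.val_mul, Units.val_mul, Matrix.trace_units_conj, coe_scalar_mul_eq_smul, Matrix.trace_smul, smul_eq_mul]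

/-- **The centred matrix of `P·(s·g)·P⁻¹` is `P·(s·(g − ½tr g·1))·P⁻¹`** (centring commutes with a unit rescaling and a change of frame). [cite: Kottwitz1986, §3] [cite: LabesseLanglands1979, §2] -/
theorem coe_conj_scalar_mul_sub_half_trace_eq (P g : GL (Fin 2) K) (s : Kˣ) :
    ((P * (Matrix.GeneralLinearGroup.scalar (Fin 2) s * g) * P⁻¹ : GL (Fin 2) K) : Matrix (Fin 2) (Fin 2) K) -
        (((P * (Matrix.GeneralLinearGroup.scalar (Fin 2) s * g) * P⁻¹ : GL (Fin 2) K) : Matrix (Fin 2) (Fin 2) K).trace / 2) • (1 : Matrix (Fin 2) (Fin 2) K) =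
      (P : Matrix (Fin 2) (Fin 2) K) * ((s : K) • ((g : Matrix (Fin 2) (Fin 2) K) - ((g : Matrix (Fin 2) (Fin 2) K).trace / 2) • (1 : Matrix (Fin 2) (Fin 2) K))) *
        ((P⁻¹ : GL (Fin 2) K) : Matrix (Fin 2) (Fin 2) K) := by
  rw [trace_coe_conj_scalar_mul, Units.val_mul, Units.val_mul, coe_scalar_mul_eq_smul]
  have hPP : (P : Matrix (Fin 2) (Fin 2) K) * ((P⁻¹ : GL (Fin 2) K) : Matrix (Fin 2) (Fin 2) K) = 1 := by
    rw [← Units.val_mul, mul_inv_cancel, Units.val_one]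
  rw [smul_sub, Matrix.mul_sub, Matrix.sub_mul, smul_smul, Matrix.mul_smul, Matrix.mul_smul, Matrix.mul_one, Matrix.smul_mul, Matrix.smul_mul, hPP,
    mul_div_assoc]

/-- **`det(P·(s·g)·P⁻¹ − 1) = s²·det(g − u·1)`** for `s·u = 1` — the value gap of the re-rooted centred block is `χ_g(u)` up to a unit. [cite: Kottwitz1986, §3] [cite: Rogawski1990, §4.9 p. 55] -/
theorem det_coe_conj_scalar_mul_sub_one (P g : GL (Fin 2) K) {s u : K} (s' : Kˣ) (hs' : (s' : K) = s) (hs : s * u = 1) :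
    (((P * (Matrix.GeneralLinearGroup.scalar (Fin 2) s' * g) * P⁻¹ : GL (Fin 2) K) : Matrix (Fin 2) (Fin 2) K) - 1).det =
      s ^ 2 * ((g : Matrix (Fin 2) (Fin 2) K) - u • (1 : Matrix (Fin 2) (Fin 2) K)).det := by
  have hPP : (P : Matrix (Fin 2) (Fin 2) K) * ((P⁻¹ : GL (Fin 2) K) : Matrix (Fin 2) (Fin 2) K) = 1 := by
    rw [← Units.val_mul, mul_inv_cancel, Units.val_one]
  have e : ((P * (Matrix.GeneralLinearGroup.scalar (Fin 2) s' * g) * P⁻¹ : GL (Fin 2) K) : Matrix (Fin 2) (Fin 2) K) - 1 =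
      (P : Matrix (Fin 2) (Fin 2) K) * (s • ((g : Matrix (Fin 2) (Fin 2) K) - u • (1 : Matrix (Fin 2) (Fin 2) K))) * ((P⁻¹ : GL (Fin 2) K) : Matrix (Fin 2) (Fin 2) K) := by
    rw [Units.val_mul, Units.val_mul, coe_scalar_mul_eq_smul, hs', smul_sub, smul_smul, hs, one_smul, Matrix.mul_sub, Matrix.sub_mul, Matrix.mul_one, hPP]
  rw [e, Matrix.det_units_conj, Matrix.det_smul, Fintype.card_fin]

end Generic

section Transport

variable {K : Type*} [Field K] [Valued K ℤᵐ⁰] {σ : K →+* K} {ϖ : K}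

/-- A unit scalar does not change a level token: `(s·A)M ⊆ cM ↔ AM ⊆ cM` for `|s| = 1` (★ F0P3a-p05 `map_toLin'_le_scaleLattice_of_eq_smul_add_smul` at `t = 0`). [cite: Kottwitz1986, §3] -/
theorem map_toLin'_smul_le_scaleLattice_iff {s : K} (hs : Valued.v s = 1) (A : Matrix (Fin 2) (Fin 2) K) {c : K} (hc : c ≠ 0) (M : Submodule 𝒪[K] (Fin 2 → K)) :
    M.map ((Matrix.toLin' (s • A)).restrictScalars 𝒪[K]) ≤ scaleLattice c M ↔ M.map ((Matrix.toLin' A).restrictScalars 𝒪[K]) ≤ scaleLattice c M := by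
  have hs0 : s ≠ 0 := fun h => by rw [h, map_zero] at hs; exact zero_ne_one hs
  have h1 : s • A = s • A + (0 : K) • (1 : Matrix (Fin 2) (Fin 2) K) := by rw [zero_smul, add_zero]
  have h2 : A = s⁻¹ • (s • A) + (0 : K) • (1 : Matrix (Fin 2) (Fin 2) K) := by rw [smul_smul, inv_mul_cancel₀ hs0, one_smul, zero_smul, add_zero]
  have h0c : Valued.v (0 : K) ≤ Valued.v c := by rw [map_zero]; exact zero_le
  exact ⟨map_toLin'_le_scaleLattice_of_eq_smul_add_smul h2 (by rw [map_inv₀, hs, inv_one]) hc h0c M,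
    map_toLin'_le_scaleLattice_of_eq_smul_add_smul h1 hs.le hc h0c M⟩

/-- **THE CENTRED-BALL COUNT OF `P·(s·g)·P⁻¹` IS THAT OF `g`** (`P ∈ U(σ, H)`, `|s| = 1`, any scale `c ≠ 0`): `#{M ∣ SD_H M ∧ (P(sg)P⁻¹)M = M ∧ (P(sg)P⁻¹ − ½tr·1)M ⊆ cM} =
#{M ∣ SD_H M ∧ gM = M ∧ (g − ½tr g·1)M ⊆ cM}` — ★ `ncard_selfDual_fixed_sep_conj_eq_of_mem_unitaryGroupOfForm` (`M ↦ P·M`) with the centred token, ★ `mapGL_eq_of_coe_eq_smul` (the scalar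
fixes the same lattices). [cite: Kottwitz1986, §3] [cite: BruhatTits1972, §10] [cite: LabesseLanglands1979, §2 Lemma 2.1] -/
theorem ncard_selfDual_fixed_centredBall_conj_scalar_mul_eq (H : Matrix (Fin 2) (Fin 2) K) {P : GL (Fin 2) K} (hP : P ∈ unitaryGroupOfForm σ H)
    (g : GL (Fin 2) K) {s : Kˣ} (hs : Valued.v (s : K) = 1) {c : K} (hc : c ≠ 0) :
    {M : Submodule 𝒪[K] (Fin 2 → K) | IsSelfDualLattice σ ϖ H M ∧ mapGL (P * (Matrix.GeneralLinearGroup.scalar (Fin 2) s * g) * P⁻¹) M = M ∧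
        M.map ((Matrix.toLin' (((P * (Matrix.GeneralLinearGroup.scalar (Fin 2) s * g) * P⁻¹ : GL (Fin 2) K) : Matrix (Fin 2) (Fin 2) K) -
          (((P * (Matrix.GeneralLinearGroup.scalar (Fin 2) s * g) * P⁻¹ : GL (Fin 2) K) : Matrix (Fin 2) (Fin 2) K).trace / 2) • (1 : Matrix (Fin 2) (Fin 2) K))).restrictScalars 𝒪[K]) ≤
          scaleLattice c M}.ncard =
      {M : Submodule 𝒪[K] (Fin 2 → K) | IsSelfDualLattice σ ϖ H M ∧ mapGL g M = M ∧
        M.map ((Matrix.toLin' ((g : Matrix (Fin 2) (Fin 2) K) - ((g : Matrix (Fin 2) (Fin 2) K).trace / 2) • (1 : Matrix (Fin 2) (Fin 2) K))).restrictScalars 𝒪[K]) ≤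
          scaleLattice c M}.ncard := by
  rw [ncard_selfDual_fixed_sep_conj_eq_of_mem_unitaryGroupOfForm σ ϖ H hP (Matrix.GeneralLinearGroup.scalar (Fin 2) s * g) _
    (fun M => M.map ((Matrix.toLin' ((g : Matrix (Fin 2) (Fin 2) K) - ((g : Matrix (Fin 2) (Fin 2) K).trace / 2) • (1 : Matrix (Fin 2) (Fin 2) K))).restrictScalars 𝒪[K]) ≤
      scaleLattice c M) ?_]
  · congr 1
    ext M
    simp only [Set.mem_setOf_eq]
    rw [mapGL_eq_of_coe_eq_smul hs (coe_scalar_mul_eq_smul s g)]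
  · intro M
    rw [coe_conj_scalar_mul_sub_half_trace_eq, map_toLin'_conj_mapGL_le_scaleLattice_iff, map_toLin'_smul_le_scaleLattice_iff hs _ hc]

/-- The same in the `k⁻¹ _ k` spelling of the re-rooted centred block `B₀ = k⁻¹(s·g)k` (`k ∈ U(σ, H)`). [cite: Kottwitz1986, §3] [cite: LabesseLanglands1979, §2 Lemma 2.1] -/
theorem ncard_selfDual_fixed_centredBall_inv_conj_scalar_mul_eq (H : Matrix (Fin 2) (Fin 2) K) {k : GL (Fin 2) K} (hk : k ∈ unitaryGroupOfForm σ H)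
    (g : GL (Fin 2) K) {s : Kˣ} (hs : Valued.v (s : K) = 1) {c : K} (hc : c ≠ 0) :
    {M : Submodule 𝒪[K] (Fin 2 → K) | IsSelfDualLattice σ ϖ H M ∧ mapGL (k⁻¹ * (Matrix.GeneralLinearGroup.scalar (Fin 2) s * g) * k) M = M ∧
        M.map ((Matrix.toLin' (((k⁻¹ * (Matrix.GeneralLinearGroup.scalar (Fin 2) s * g) * k : GL (Fin 2) K) : Matrix (Fin 2) (Fin 2) K) -
          (((k⁻¹ * (Matrix.GeneralLinearGroup.scalar (Fin 2) s * g) * k : GL (Fin 2) K) : Matrix (Fin 2) (Fin 2) K).trace / 2) • (1 : Matrix (Fin 2) (Fin 2) K))).restrictScalars 𝒪[K]) ≤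
          scaleLattice c M}.ncard =
      {M : Submodule 𝒪[K] (Fin 2 → K) | IsSelfDualLattice σ ϖ H M ∧ mapGL g M = M ∧
        M.map ((Matrix.toLin' ((g : Matrix (Fin 2) (Fin 2) K) - ((g : Matrix (Fin 2) (Fin 2) K).trace / 2) • (1 : Matrix (Fin 2) (Fin 2) K))).restrictScalars 𝒪[K]) ≤
          scaleLattice c M}.ncard := by
  simpa only [inv_inv] using ncard_selfDual_fixed_centredBall_conj_scalar_mul_eq (ϖ := ϖ) H (Subgroup.inv_mem _ hk) g hs hc

/-- `tr(k⁻¹(s·g)k) = s·tr g` (`k⁻¹ _ k` spelling). [cite: Kottwitz1986, §3] -/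
theorem trace_coe_inv_conj_scalar_mul {K : Type*} [Field K] (k g : GL (Fin 2) K) (s : Kˣ) :
    ((k⁻¹ * (Matrix.GeneralLinearGroup.scalar (Fin 2) s * g) * k : GL (Fin 2) K) : Matrix (Fin 2) (Fin 2) K).trace = (s : K) * (g : Matrix (Fin 2) (Fin 2) K).trace := by
  simpa only [inv_inv] using trace_coe_conj_scalar_mul k⁻¹ g s

/-- `det(k⁻¹(s·g)k − 1) = s²·det(g − u·1)` for `s·u = 1` (`k⁻¹ _ k` spelling). [cite: Kottwitz1986, §3] [cite: Rogawski1990, §4.9 p. 55] -/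
theorem det_coe_inv_conj_scalar_mul_sub_one {K : Type*} [Field K] (k g : GL (Fin 2) K) {s u : K} (s' : Kˣ) (hs' : (s' : K) = s) (hs : s * u = 1) :
    (((k⁻¹ * (Matrix.GeneralLinearGroup.scalar (Fin 2) s' * g) * k : GL (Fin 2) K) : Matrix (Fin 2) (Fin 2) K) - 1).det =
      s ^ 2 * ((g : Matrix (Fin 2) (Fin 2) K) - u • (1 : Matrix (Fin 2) (Fin 2) K)).det := by
  simpa only [inv_inv] using det_coe_conj_scalar_mul_sub_one k⁻¹ g s' hs' hs

end Transport


end Literature.NumberTheory.Automorphic.UnitaryLatticeTree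

/-! ## §3 The CM dress: the W-side set of `B₀ = k⁻¹(s·ĝ_w)k` counted by A-p12's centred balls of `ĝ_w`; THM 5's value gap from `hm`; the root region of `Γ` -/

namespace Literature.NumberTheory.Rogawski1990

variable (L : Type) [Field L] [NumberField L] [IsCMField L] {v : HeightOneSpectrum (𝓞 ↥(maximalRealSubfield L))}
  (w : PlacesOver L v) (hw : IsCMField.complexConj L • w.1 = w.1)

/-- **THE W-SIDE SET OF `B₀` IS COUNTED BY A-p12's CENTRED BALL OF `ĝ_w`** (scale `d` with `|2û₀₀ − tr ĝ_w|_w ≤ |ϖ^d|`): THM 5's right-hand set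
`{B ∣ SD_{!![0,1;1,0]} B ∧ B₀·B = B ∧ (B₀ − 1)B ⊆ ϖ^d B}` at `γ₂ := B₀ = k⁻¹(s·ĝ_w)k` has the cardinality of ★ p848780's `{B ∣ SD B ∧ ĝ_w·B = B ∧ (ĝ_w − ½tr ĝ_w·1)B ⊆ ϖ^d B}`
(★ A-p12 `selfDual_fixed_lev_eq_ball_of_le` at `Γ := B₀` ∘ §2). [cite: Kottwitz1986, §3] [cite: LabesseLanglands1979, §2 Lemma 2.1] [cite: Rogawski1990, §4.9 Lemma 4.9.3] -/
theorem ncard_selfDual_fixed_lev_rerootedCentred_eq_ncard_ball_ram (he : v.asIdeal.ramificationIdx' w.1.asIdeal ≠ 1)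
    (h2 : IsUnit (2 : (ValuativeRel.valuation (w.1.adicCompletion L)).integer))
    (ϖ : w.1.adicCompletion L) (hϖ : Valued.v ϖ = WithZero.exp (-1 : ℤ))
    (γH : (cmDatum L 2 (Matrix.of fun i j : Fin 2 => if i.val + j.val + 1 = 2 then (1 : L) else 0)).Local v ×
      (cmDatum L 1 (Matrix.of fun i j : Fin 1 => if i.val + j.val + 1 = 1 then (1 : L) else 0)).Local v)
    (s : (w.1.adicCompletion L)ˣ)
    (hs : (s : w.1.adicCompletion L) * (((localNonsplitEquiv (IsCMField.complexConj L) (Matrix.of fun i j : Fin 1 => if i.val + j.val + 1 = 1 then (1 : L) else 0)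
        (IsCMField.complexConj_ne_one L) w hw γH.2).val : GL (Fin 1) (w.1.adicCompletion L)) : Matrix (Fin 1) (Fin 1) (w.1.adicCompletion L)) 0 0 = 1)
    (k : GL (Fin 2) (w.1.adicCompletion L))
    (hk : k ∈ unitaryGroupOfForm (galAdicCompletionMap (L := L) (IsCMField.complexConj L) hw)
      (placeForm (Matrix.of fun i j : Fin 2 => if i.val + j.val + 1 = 2 then (1 : L) else 0) w.1))
    (d : ℕ) (hsc : Valued.v (2 * finGammaTwo L v γH w - ((((γH.1.val : GL (Fin 2) (UnitaryGroup.LocalRing L v)).val.map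
      (Pi.evalRingHom (fun w' : PlacesOver L v => w'.1.adicCompletion L) w)))).trace) ≤ Valued.v (ϖ ^ d)) :
    {B : Submodule (Valued.integer (w.1.adicCompletion L)) (Fin 2 → (w.1.adicCompletion L)) |
        IsSelfDualLattice (galAdicCompletionMap (L := L) (IsCMField.complexConj L) hw) ϖ (!![(0 : w.1.adicCompletion L), 1; 1, 0] : Matrix (Fin 2) (Fin 2) (w.1.adicCompletion L)) B ∧
        mapGL (k⁻¹ * (Matrix.GeneralLinearGroup.scalar (Fin 2) s *
          ((localNonsplitEquiv (IsCMField.complexConj L) (Matrix.of fun i j : Fin 2 => if i.val + j.val + 1 = 2 then (1 : L) else 0)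
            (IsCMField.complexConj_ne_one L) w hw γH.1).val : GL (Fin 2) (w.1.adicCompletion L))) * k) B = B ∧
        B.map ((Matrix.toLin' (((k⁻¹ * (Matrix.GeneralLinearGroup.scalar (Fin 2) s *
          ((localNonsplitEquiv (IsCMField.complexConj L) (Matrix.of fun i j : Fin 2 => if i.val + j.val + 1 = 2 then (1 : L) else 0)
            (IsCMField.complexConj_ne_one L) w hw γH.1).val : GL (Fin 2) (w.1.adicCompletion L))) * k : GL (Fin 2) (w.1.adicCompletion L)) :
              Matrix (Fin 2) (Fin 2) (w.1.adicCompletion L)) - 1)).restrictScalars (Valued.integer (w.1.adicCompletion L))) ≤ scaleLattice (ϖ ^ d) B}.ncard =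
      {B : Submodule (Valued.integer (w.1.adicCompletion L)) (Fin 2 → (w.1.adicCompletion L)) |
        IsSelfDualLattice (galAdicCompletionMap (L := L) (IsCMField.complexConj L) hw) ϖ (!![(0 : w.1.adicCompletion L), 1; 1, 0] : Matrix (Fin 2) (Fin 2) (w.1.adicCompletion L)) B ∧
        mapGL ((localNonsplitEquiv (IsCMField.complexConj L) (Matrix.of fun i j : Fin 2 => if i.val + j.val + 1 = 2 then (1 : L) else 0)
            (IsCMField.complexConj_ne_one L) w hw γH.1).val : GL (Fin 2) (w.1.adicCompletion L)) B = B ∧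
        B.map ((Matrix.toLin' ((((localNonsplitEquiv (IsCMField.complexConj L) (Matrix.of fun i j : Fin 2 => if i.val + j.val + 1 = 2 then (1 : L) else 0)
            (IsCMField.complexConj_ne_one L) w hw γH.1).val : GL (Fin 2) (w.1.adicCompletion L)) : Matrix (Fin 2) (Fin 2) (w.1.adicCompletion L)) -
          ((((localNonsplitEquiv (IsCMField.complexConj L) (Matrix.of fun i j : Fin 2 => if i.val + j.val + 1 = 2 then (1 : L) else 0)
            (IsCMField.complexConj_ne_one L) w hw γH.1).val : GL (Fin 2) (w.1.adicCompletion L)) : Matrix (Fin 2) (Fin 2) (w.1.adicCompletion L)).trace / 2) •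
            (1 : Matrix (Fin 2) (Fin 2) (w.1.adicCompletion L)))).restrictScalars (Valued.integer (w.1.adicCompletion L))) ≤ scaleLattice (ϖ ^ d) B}.ncard := by
  have hϖ0 : ϖ ≠ 0 := fun h0 => by rw [h0, map_zero] at hϖ; exact WithZero.coe_ne_zero hϖ.symm
  have h2w : Valued.v (2 : (w.1.adicCompletion L)) = 1 := (isUnit_two_integer_iff_valued_eq_one L w.1).1 h2
  have hsv : Valued.v (s : w.1.adicCompletion L) = 1 := by
    have h := congrArg Valued.v hs
    rwa [map_mul, v_oneByOne_eq_one_of_local L w hw γH.2, mul_one, map_one] at h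
  -- (i) the level token of `B₀` is its centred-ball token (A-p12 §3 at `Γ := B₀`)
  have hck : Valued.v (((k⁻¹ * (Matrix.GeneralLinearGroup.scalar (Fin 2) s *
      ((localNonsplitEquiv (IsCMField.complexConj L) (Matrix.of fun i j : Fin 2 => if i.val + j.val + 1 = 2 then (1 : L) else 0)
        (IsCMField.complexConj_ne_one L) w hw γH.1).val : GL (Fin 2) (w.1.adicCompletion L))) * k : GL (Fin 2) (w.1.adicCompletion L)) :
          Matrix (Fin 2) (Fin 2) (w.1.adicCompletion L)).trace / 2 - 1) ≤ Valued.v (((Units.mk0 ϖ hϖ0 : (w.1.adicCompletion L)ˣ) : w.1.adicCompletion L) ^ d) := by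
    rw [trace_coe_inv_conj_scalar_mul, mul_div_assoc, v_mul_trace_div_two_sub_one_eq h2w hs hsv, Units.val_mk0, coe_localNonsplitEquiv_apply]
    exact hsc
  have e := selfDual_fixed_lev_eq_ball_of_le L v w hw he h2 (Units.mk0 ϖ hϖ0) (ϖ' := ϖ) _ d hck
  simp only [Units.val_mk0] at e
  rw [e]
  -- (ii) transport along `B ↦ k·B` and drop the unit scalar
  have hk' : k ∈ unitaryGroupOfForm (galAdicCompletionMap (L := L) (IsCMField.complexConj L) hw) (!![(0 : w.1.adicCompletion L), 1; 1, 0] : Matrix (Fin 2) (Fin 2) (w.1.adicCompletion L)) := by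
    rw [← stdForm_antidiagonal_two_over_eq, ← placeForm_antidiagOne]; exact hk
  exact ncard_selfDual_fixed_centredBall_inv_conj_scalar_mul_eq _ hk' _ hsv (pow_ne_zero d hϖ0)

/-- **THE VALUE GAP OF `B₀` FROM THE J0diff's `hm`**: `|det(↑B₀ − 1)|_w = |ϖ|^(2m)` — `det(B₀ − 1) = s²·det(ĝ_w − û₀₀·1) = s²·χ_{ĝ_w}(û₀₀)` (§1), `χ_{ĝ_w}(û₀₀) = (χ_g(u))_w`
(★ `eval_finCharpolyTwo_finGammaTwo_apply_eq_quadratic`), `|(χ_g(u))_w| = |ι_w ϖ_v^m|` (`hm`), `|ι_w ϖ_v| = |ϖ|²` at the ramified place. [cite: Rogawski1990, §4.9 p. 55] [cite: Kottwitz1986, §3] -/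
theorem v_det_rerootedCentred_sub_one_eq_ram (he : v.asIdeal.ramificationIdx' w.1.asIdeal ≠ 1)
    (ϖ : w.1.adicCompletion L) (hϖ : Valued.v ϖ = WithZero.exp (-1 : ℤ))
    (γH : (cmDatum L 2 (Matrix.of fun i j : Fin 2 => if i.val + j.val + 1 = 2 then (1 : L) else 0)).Local v ×
      (cmDatum L 1 (Matrix.of fun i j : Fin 1 => if i.val + j.val + 1 = 1 then (1 : L) else 0)).Local v)
    (m : ℕ) (hm : Valued.v (((finCharpolyTwo L v γH).eval (finGammaTwo L v γH)) w) =
      Valued.v ((toPlace v w (HeckeCharacter.uniformizer ↥(maximalRealSubfield L) v : v.adicCompletion ↥(maximalRealSubfield L))) ^ m))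
    (s : (w.1.adicCompletion L)ˣ)
    (hs : (s : w.1.adicCompletion L) * (((localNonsplitEquiv (IsCMField.complexConj L) (Matrix.of fun i j : Fin 1 => if i.val + j.val + 1 = 1 then (1 : L) else 0)
        (IsCMField.complexConj_ne_one L) w hw γH.2).val : GL (Fin 1) (w.1.adicCompletion L)) : Matrix (Fin 1) (Fin 1) (w.1.adicCompletion L)) 0 0 = 1)
    (k : GL (Fin 2) (w.1.adicCompletion L)) :
    Valued.v ((((k⁻¹ * (Matrix.GeneralLinearGroup.scalar (Fin 2) s *
        ((localNonsplitEquiv (IsCMField.complexConj L) (Matrix.of fun i j : Fin 2 => if i.val + j.val + 1 = 2 then (1 : L) else 0)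
          (IsCMField.complexConj_ne_one L) w hw γH.1).val : GL (Fin 2) (w.1.adicCompletion L))) * k : GL (Fin 2) (w.1.adicCompletion L)) :
            Matrix (Fin 2) (Fin 2) (w.1.adicCompletion L)) - 1).det) = Valued.v ϖ ^ (2 * m) := by
  have hsv : Valued.v (s : w.1.adicCompletion L) = 1 := by
    have h := congrArg Valued.v hs
    rwa [map_mul, v_oneByOne_eq_one_of_local L w hw γH.2, mul_one, map_one] at h
  have hvP := (valued_toPlace_uniformizer_of_ramified L (IsCMField.complexConj L) (IsCMField.complexConj_ne_one L) w hw he).1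
  rw [det_coe_inv_conj_scalar_mul_sub_one k _ s rfl hs, map_mul, map_pow, hsv, one_pow, one_mul, ← eval_charpoly_fin_two_eq_det_sub_smul_one]
  -- `χ_{ĝ_w}(û₀₀) = (χ_g(u))_w`
  have hq := eval_finCharpolyTwo_finGammaTwo_apply_eq_quadratic L v w γH
  have hev : (((localNonsplitEquiv (IsCMField.complexConj L) (Matrix.of fun i j : Fin 2 => if i.val + j.val + 1 = 2 then (1 : L) else 0)
        (IsCMField.complexConj_ne_one L) w hw γH.1).val : GL (Fin 2) (w.1.adicCompletion L)) : Matrix (Fin 2) (Fin 2) (w.1.adicCompletion L)).charpoly.eval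
      ((((localNonsplitEquiv (IsCMField.complexConj L) (Matrix.of fun i j : Fin 1 => if i.val + j.val + 1 = 1 then (1 : L) else 0)
        (IsCMField.complexConj_ne_one L) w hw γH.2).val : GL (Fin 1) (w.1.adicCompletion L)) : Matrix (Fin 1) (Fin 1) (w.1.adicCompletion L)) 0 0) =
      ((finCharpolyTwo L v γH).eval (finGammaTwo L v γH)) w := by
    rw [coe_localNonsplitEquiv_apply, coe_localNonsplitEquiv_apply, hq, eval_charpoly_fin_two_eq_det_sub_smul_one, Matrix.det_fin_two, Matrix.trace_fin_two,
      Matrix.det_fin_two]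
    simp only [Matrix.sub_apply, Matrix.smul_apply, Matrix.map_apply, Matrix.one_apply_eq, ne_eq, zero_ne_one, not_false_eq_true, Matrix.one_apply_ne, one_ne_zero,
      smul_eq_mul, mul_one, mul_zero, sub_zero, Pi.evalRingHom_apply, finGammaTwo]
    ring
  rw [hev, hm, map_pow, hvP, hϖ, ← WithZero.exp_nsmul, ← WithZero.exp_nsmul]
  congr 1; ring

/-- **THE ROOT REGION OF `Γ = ι(B₀, 1)` COUNTED BY A-p12's CENTRED BALL OF `ĝ_w`** (the pen's `sR.card`): for `γ ∈ U(σ_w, J₀)` with `↑γ = ι(k⁻¹(s·ĝ_w)k, 1)`, a level `d`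
with `m ≤ d` (value gap: `|ϖ|^(2d+1) < |det(B₀ − 1)| = |ϖ|^(2m)`) and `|2û₀₀ − tr ĝ_w|_w ≤ |ϖ^d|` (regime B: `d = m`, ★ `typeTwo_depthDictionary_*` clause 2), THM 5 (★ p849125,
F0P3a-p01 (g18)) ∘ `ncard_selfDual_fixed_lev_rerootedCentred_eq_ncard_ball_ram`:
`#{v ∣ γ·v = v ∧ SD v.1 ∧ (γ − 1)·v.1 ⊆ ϖ^d·v.1} = #{B ∣ SD_{!![0,1;1,0]} B ∧ ĝ_w·B = B ∧ (ĝ_w − ½tr ĝ_w·1)B ⊆ ϖ^d B}`. [cite: Kottwitz1986, §3] [cite: Rogawski1990, §4.9 Lemma 4.9.3]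
[cite: LabesseLanglands1979, §2 Lemma 2.1] [cite: BruhatTits1972, §10] -/
theorem ncard_rootRegion_rerootedCentred_eq_ncard_ball_ram (he : v.asIdeal.ramificationIdx' w.1.asIdeal ≠ 1)
    (h2 : IsUnit (2 : (ValuativeRel.valuation (w.1.adicCompletion L)).integer))
    (ϖ : w.1.adicCompletion L) (hϖ : Valued.v ϖ = WithZero.exp (-1 : ℤ))
    (γH : (cmDatum L 2 (Matrix.of fun i j : Fin 2 => if i.val + j.val + 1 = 2 then (1 : L) else 0)).Local v ×
      (cmDatum L 1 (Matrix.of fun i j : Fin 1 => if i.val + j.val + 1 = 1 then (1 : L) else 0)).Local v)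
    (m : ℕ) (hm : Valued.v (((finCharpolyTwo L v γH).eval (finGammaTwo L v γH)) w) =
      Valued.v ((toPlace v w (HeckeCharacter.uniformizer ↥(maximalRealSubfield L) v : v.adicCompletion ↥(maximalRealSubfield L))) ^ m))
    (s : (w.1.adicCompletion L)ˣ)
    (hs : (s : w.1.adicCompletion L) * (((localNonsplitEquiv (IsCMField.complexConj L) (Matrix.of fun i j : Fin 1 => if i.val + j.val + 1 = 1 then (1 : L) else 0)
        (IsCMField.complexConj_ne_one L) w hw γH.2).val : GL (Fin 1) (w.1.adicCompletion L)) : Matrix (Fin 1) (Fin 1) (w.1.adicCompletion L)) 0 0 = 1)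
    (k : GL (Fin 2) (w.1.adicCompletion L))
    (hk : k ∈ unitaryGroupOfForm (galAdicCompletionMap (L := L) (IsCMField.complexConj L) hw)
      (placeForm (Matrix.of fun i j : Fin 2 => if i.val + j.val + 1 = 2 then (1 : L) else 0) w.1))
    (γ : unitaryGroupOfForm (galAdicCompletionMap (L := L) (IsCMField.complexConj L) hw) ((StdForm.antidiagonal 3).over (w.1.adicCompletion L)))
    (hγ : (γ : GL (Fin 3) (w.1.adicCompletion L)) = endoGL (k⁻¹ * (Matrix.GeneralLinearGroup.scalar (Fin 2) s *
        ((localNonsplitEquiv (IsCMField.complexConj L) (Matrix.of fun i j : Fin 2 => if i.val + j.val + 1 = 2 then (1 : L) else 0)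
          (IsCMField.complexConj_ne_one L) w hw γH.1).val : GL (Fin 2) (w.1.adicCompletion L))) * k, (1 : GL (Fin 1) (w.1.adicCompletion L))))
    (d : ℕ) (hmd : m ≤ d) (hsc : Valued.v (2 * finGammaTwo L v γH w - ((((γH.1.val : GL (Fin 2) (UnitaryGroup.LocalRing L v)).val.map
      (Pi.evalRingHom (fun w' : PlacesOver L v => w'.1.adicCompletion L) w)))).trace) ≤ Valued.v (ϖ ^ d)) :
    {x : {M : Submodule (Valued.integer (w.1.adicCompletion L)) (Fin 3 → (w.1.adicCompletion L)) //
          IsVertex (galAdicCompletionMap (L := L) (IsCMField.complexConj L) hw) ϖ ((StdForm.antidiagonal 3).over (w.1.adicCompletion L)) M} |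
        latticeGraphIso (galAdicCompletionMap (L := L) (IsCMField.complexConj L) hw) ϖ ((StdForm.antidiagonal 3).over (w.1.adicCompletion L)) γ x = x ∧
          IsSelfDualLattice (galAdicCompletionMap (L := L) (IsCMField.complexConj L) hw) ϖ ((StdForm.antidiagonal 3).over (w.1.adicCompletion L)) x.1 ∧
          x.1.map ((Matrix.toLin' (((γ : GL (Fin 3) (w.1.adicCompletion L)) : Matrix (Fin 3) (Fin 3) (w.1.adicCompletion L)) - 1)).restrictScalars
            (Valued.integer (w.1.adicCompletion L))) ≤ scaleLattice (ϖ ^ d) x.1}.ncard =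
      {B : Submodule (Valued.integer (w.1.adicCompletion L)) (Fin 2 → (w.1.adicCompletion L)) |
        IsSelfDualLattice (galAdicCompletionMap (L := L) (IsCMField.complexConj L) hw) ϖ (!![(0 : w.1.adicCompletion L), 1; 1, 0] : Matrix (Fin 2) (Fin 2) (w.1.adicCompletion L)) B ∧
        mapGL ((localNonsplitEquiv (IsCMField.complexConj L) (Matrix.of fun i j : Fin 2 => if i.val + j.val + 1 = 2 then (1 : L) else 0)
            (IsCMField.complexConj_ne_one L) w hw γH.1).val : GL (Fin 2) (w.1.adicCompletion L)) B = B ∧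
        B.map ((Matrix.toLin' ((((localNonsplitEquiv (IsCMField.complexConj L) (Matrix.of fun i j : Fin 2 => if i.val + j.val + 1 = 2 then (1 : L) else 0)
            (IsCMField.complexConj_ne_one L) w hw γH.1).val : GL (Fin 2) (w.1.adicCompletion L)) : Matrix (Fin 2) (Fin 2) (w.1.adicCompletion L)) -
          ((((localNonsplitEquiv (IsCMField.complexConj L) (Matrix.of fun i j : Fin 2 => if i.val + j.val + 1 = 2 then (1 : L) else 0)
            (IsCMField.complexConj_ne_one L) w hw γH.1).val : GL (Fin 2) (w.1.adicCompletion L)) : Matrix (Fin 2) (Fin 2) (w.1.adicCompletion L)).trace / 2) •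
            (1 : Matrix (Fin 2) (Fin 2) (w.1.adicCompletion L)))).restrictScalars (Valued.integer (w.1.adicCompletion L))) ≤ scaleLattice (ϖ ^ d) B}.ncard := by
  haveI := isPrincipalIdealRing_integer_adicCompletion L v w
  have hϖ0 : ϖ ≠ 0 := fun h0 => by rw [h0, map_zero] at hϖ; exact WithZero.coe_ne_zero hϖ.symm
  have hϖlt : Valued.v ϖ < 1 := by rw [hϖ, ← WithZero.exp_zero]; exact WithZero.exp_lt_exp.2 (by norm_num)
  have hvϖ0 : 0 < Valued.v ϖ := by rw [hϖ]; exact WithZero.exp_pos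
  have hσ : ∀ a, galAdicCompletionMap (L := L) (IsCMField.complexConj L) hw (galAdicCompletionMap (L := L) (IsCMField.complexConj L) hw a) = a :=
    galAdicCompletionMap_galAdicCompletionMap_of_smul_eq (IsCMField.complexConj L) w (IsCMField.complexConj_ne_one L) hw
  have hdet : Valued.v ϖ ^ (2 * d + 1) < Valued.v ((((k⁻¹ * (Matrix.GeneralLinearGroup.scalar (Fin 2) s *
      ((localNonsplitEquiv (IsCMField.complexConj L) (Matrix.of fun i j : Fin 2 => if i.val + j.val + 1 = 2 then (1 : L) else 0)
        (IsCMField.complexConj_ne_one L) w hw γH.1).val : GL (Fin 2) (w.1.adicCompletion L))) * k : GL (Fin 2) (w.1.adicCompletion L)) :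
          Matrix (Fin 2) (Fin 2) (w.1.adicCompletion L)) - (((1 : GL (Fin 1) (w.1.adicCompletion L)) : Matrix (Fin 1) (Fin 1) (w.1.adicCompletion L)) 0 0) •
          (1 : Matrix (Fin 2) (Fin 2) (w.1.adicCompletion L))).det) := by
    rw [Units.val_one, Matrix.one_apply_eq, one_smul, v_det_rerootedCentred_sub_one_eq_ram L w hw he ϖ hϖ γH m hm s hs k]
    exact pow_lt_pow_right_of_lt_one₀ hvϖ0 hϖlt (by omega)
  rw [ncard_rootRegion_eq_ncard_two_of_coe_eq_endoGL hσ (fun x => valued_galAdicCompletionMap (L := L) (IsCMField.complexConj L) hw x) hϖ γ _ 1 hγ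
    (by rw [Units.val_one, Matrix.one_apply_eq, map_one]) (by rw [Units.val_one, Matrix.one_apply_eq, sub_self, map_zero]; exact zero_le) hdet]
  exact ncard_selfDual_fixed_lev_rerootedCentred_eq_ncard_ball_ram L w hw he h2 ϖ hϖ γH s hs k hk d hsc

end Literature.NumberTheory.Rogawski1990

end
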